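/-
Copyright (c) 2026. All rights reserved.
Released under Apache 2.0 license as described in the file LICENSE.
-/
import Literature.Probability.FitznerVanDerHofstad2017.SrwTrigMajorantKM2
import Literature.Probability.FitznerVanDerHofstad2017.SrwTrigMajorantGlue
import HarnessLib

/-!
# The KU-SEP reduction under a DOMINATING polynomial weight (odd `l`; `KM₂` by `gset`)

CITATION HEADER (PLACEMENT v2). Part of the certified REPRODUCTION of the numerical inputs of
R. Fitzner, R. van der Hofstad, *Generalized approach to the non-backtracking lace expansion*,
Probab. Theory Related Fields 169 (2017) 1041–1119 [NoBLE17-I] (arXiv:1506.07969), §3.3.3 and §5.2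
((3.34)–(3.38) p. 1071; (5.9), (5.14) p. 1092), as consumed by *Mean-field behavior for
nearest-neighbor percolation in `d > 10`*, Electron. J. Probab. 22 (2017) no. 43 [FvdH17].
Origin: build `lace`, unit `b2b-lace-carver-g44` (census v8, node KU-SEP: what-if / input-certification
support lane).  Nothing here is a statement about percolation and nothing is evaluated at a specific `d`.

## What is proved, and why

`SrwTrigMajorant` bounds `∫ w |D̂^{(x)}| Ĉⁿ` for a weight `0 ≤ w ≤ W` by
`B·Tw^w_n(x;0) + c·Sq^w_n(x) + Σ_r a_r·Tw^w_n(x;b_r)` whenever `|t| ≤ B + c t² + Σ_r a_r cos(b_r t)` on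
`[-1,1]` (`integral_weight_abs_DhatSym_le_of_trigMajorant`); the instances `K_{n,l}`, `U_{n,l}`, `KM₂_{n,l}`
carry the weight `|D̂|^l` (times `D̂^{sin}`, `M̂²`).  The twisted moments `Tw^w` are certified downstream
through the u-representation at axis nodes, which needs `w` to be a POLYNOMIAL in the coordinate cosines
and sines (`SrwTwistProductWeight`, `SrwTwistCosPowRow`); for EVEN `l` the weight `|D̂|^l = D̂^l` is one
(`srwTwist_abs_Dhat_pow_mul_eq_of_even`, `srwSqMom_abs_Dhat_pow_mul_eq_of_even`), for ODD `l` it is not.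
Since the majorant `B + c t² + Σ a_r cos(b_r t) ≥ |t| ≥ 0` is nonnegative on `[-1,1]`, the reduction is
MONOTONE IN THE WEIGHT: `0 ≤ w ≤ w'` gives the same bound with `w'` on the right
(`integral_weight_abs_DhatSym_le_of_trigMajorant_of_le`, and the `K`/`U`/`KM₂` forms `…_of_le`).  For odd
`l = 2j+1` the arithmetic–geometric mean `|t| ≤ (1 + t²)/2` gives the polynomial dominating weight
`|D̂|^{2j+1} ≤ (D̂^{2j} + D̂^{2j+2})/2` (`abs_pow_two_mul_add_one_le`, `abs_Dhat_pow_odd_le_polyWeight`), whence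
the hypothesis-free instances `srwK_le_gset_odd`, `srwU_le_gset_odd`, `srwKM2_le_gset_odd` with the literal
coefficients of the in-kernel majorant `gset`; `srwKM2_le_gset` (any `l`) completes the `gset` family of
`SrwTrigMajorantGlue`.  Everything is PROVED (standard axioms), `d`-generic and number-free.
Epistemic status / lane: what-if / input-certification SUPPORT; nothing here is a certificate; no statement
at a specific dimension.

## References
* R. Fitzner, R. van der Hofstad, PTRF 169 (2017) 1041–1119, §3.3.3 (3.34)–(3.38) p. 1071, §5.1.2
  (5.11)–(5.16) pp. 1091–1092, §5.2 (5.9), (5.14) p. 1092. [FitznerVanDerHofstad2016NoBLE]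
* M. Heydenreich, R. van der Hofstad, *Progress in high-dimensional percolation and random graphs* (2017),
  Prop. 5.5 (integrability of `Ĉⁿ` for `d > 2n`). [HeydenreichVanDerHofstad2017]
-/

noncomputable section

open MeasureTheory Real Finset
open scoped BigOperators

namespace Literature.Probability.FitznerVanDerHofstad2017

open TrigEncl
open Literature.Barriers.CriticalPhenomena
open Literature.Barriers.CriticalPhenomena.Slade2006Prop53 (P)

variable {d : ℕ}

/-! ### Monotonicity of the reduction in the weight -/

/-- **The KU-SEP reduction is monotone in the weight.** For `d ≥ 2n + 1`, weights `0 ≤ w ≤ w' ≤ W`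
with `w'` measurable, and a trigonometric majorant `|t| ≤ B + c t² + Σ_r a_r cos(b_r t)` on `[-1,1]`:
`∫ w |D̂^{(x)}| Ĉⁿ/(2π)^d ≤ B·Tw^{w'}_n(x;0) + c·Sq^{w'}_n(x) + Σ_r a_r·Tw^{w'}_n(x;b_r)`
(the majorant is `≥ |t| ≥ 0`, so the right-hand side only grows with the weight).
[cite: FitznerVanDerHofstad2016NoBLE, (3.36) p. 1071; (5.9) p. 1092] -/
theorem integral_weight_abs_DhatSym_le_of_trigMajorant_of_le {n : ℕ} (hd : 2 * n + 1 ≤ d)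
    {w w' : (Fin d → ℝ) → ℝ} (hw0 : ∀ k, 0 ≤ w k) (hle : ∀ k, w k ≤ w' k)
    (hw' : Measurable w') {W : ℝ} (hw1 : ∀ k, w' k ≤ W)
    (x : Fin d → ℤ) {R : ℕ} (B c : ℝ) (a b : Fin R → ℝ)
    (hmaj : ∀ t ∈ Set.Icc (-1 : ℝ) 1, |t| ≤ B + c * t ^ 2 + ∑ r, a r * Real.cos (b r * t)) :
    (∫ k, (w k * |DhatSym d x k|) * Chat d 1 k ^ n ∂P d) / (2 * π) ^ d ≤
      B * srwTwist d n w' x 0 + c * srwSqMom d n w' x + ∑ r, a r * srwTwist d n w' x (b r) := by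
  have hw0' : ∀ k, 0 ≤ w' k := fun k => (hw0 k).trans (hle k)
  refine le_trans ?_
    (integral_weight_abs_DhatSym_le_of_trigMajorant hd hw' hw0' hw1 x B c a b hmaj)
  refine div_le_div_of_nonneg_right ?_ (two_pi_pow_pos d).le
  have hbd : ∀ k, abs (w' k * |DhatSym d x k|) ≤ W := fun k => by
    rw [abs_mul, abs_abs, abs_of_nonneg (hw0' k)]
    calc w' k * |DhatSym d x k| ≤ W * 1 :=
          mul_le_mul (hw1 k) (abs_DhatSym_le_one x k) (abs_nonneg _) ((hw0' k).trans (hw1 k))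
      _ = W := mul_one W
  have hI : Integrable (fun k => (w' k * |DhatSym d x k|) * Chat d 1 k ^ n) (P d) := by
    have h1 := integrable_weight_cos_mul_Chat_pow hd (hw'.mul (measurable_DhatSym d x).abs) hbd x 0
    refine h1.congr (ae_of_all _ fun k => ?_)
    show ((w' k * |DhatSym d x k|) * Real.cos (0 * DhatSym d x k)) * Chat d 1 k ^ n
      = (w' k * |DhatSym d x k|) * Chat d 1 k ^ n
    rw [zero_mul, Real.cos_zero, mul_one]
  refine integral_mono_of_nonneg (ae_of_all _ fun k => ?_) hI (ae_of_all _ fun k => ?_)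
  · exact mul_nonneg (mul_nonneg (hw0 k) (abs_nonneg _)) (pow_nonneg (Chat_one_nonneg k) n)
  · exact mul_le_mul_of_nonneg_right (mul_le_mul_of_nonneg_right (hle k) (abs_nonneg _))
      (pow_nonneg (Chat_one_nonneg k) n)

/-- **`K_{n,l}(x)` under a dominating weight**: if `|D̂|^l ≤ w' ≤ W` (`w'` measurable), then
`K_{n,l}(x) ≤ B·Tw^{w'}_n(x;0) + c·Sq^{w'}_n(x) + Σ_r a_r·Tw^{w'}_n(x;b_r)` for any bounded majorant.
[cite: FitznerVanDerHofstad2016NoBLE, (3.36) p. 1071; (5.9) p. 1092] -/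
theorem srwK_le_of_trigMajorant_of_le {n : ℕ} (hd : 2 * n + 1 ≤ d) (l : ℕ) (x : Fin d → ℤ)
    {w' : (Fin d → ℝ) → ℝ} (hle : ∀ k, |Dhat d k| ^ l ≤ w' k) (hw' : Measurable w') {W : ℝ}
    (hw1 : ∀ k, w' k ≤ W) {R : ℕ} (B c : ℝ) (a b : Fin R → ℝ)
    (hmaj : ∀ t ∈ Set.Icc (-1 : ℝ) 1, |t| ≤ B + c * t ^ 2 + ∑ r, a r * Real.cos (b r * t)) :
    srwK d n l x ≤ B * srwTwist d n w' x 0 + c * srwSqMom d n w' x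
      + ∑ r, a r * srwTwist d n w' x (b r) := by
  rw [srwK]
  exact integral_weight_abs_DhatSym_le_of_trigMajorant_of_le hd
    (fun k => pow_nonneg (abs_nonneg _) l) hle hw' hw1 x B c a b hmaj

/-- **`U_{n,l}(x)` under a dominating weight**: if `|D̂|^l ≤ w' ≤ W` (`w'` measurable, `d ≥ 2n+1`),
then `U_{n,l}(x) ≤ B·Tw^{w' D̂^{sin}}_n(x;0) + c·Sq^{w' D̂^{sin}}_n(x) + Σ_r a_r·Tw^{w' D̂^{sin}}_n(x;b_r)`
(`0 ≤ D̂^{sin} ≤ 1/d`). [cite: FitznerVanDerHofstad2016NoBLE, (3.38) p. 1071; (5.9) p. 1092] -/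
theorem srwU_le_of_trigMajorant_of_le {n : ℕ} (hd : 2 * n + 1 ≤ d) (l : ℕ) (x : Fin d → ℤ)
    {w' : (Fin d → ℝ) → ℝ} (hle : ∀ k, |Dhat d k| ^ l ≤ w' k) (hw' : Measurable w') {W : ℝ}
    (hw1 : ∀ k, w' k ≤ W) {R : ℕ} (B c : ℝ) (a b : Fin R → ℝ)
    (hmaj : ∀ t ∈ Set.Icc (-1 : ℝ) 1, |t| ≤ B + c * t ^ 2 + ∑ r, a r * Real.cos (b r * t)) :
    srwU d n l x ≤ B * srwTwist d n (fun k => w' k * Dsin d k) x 0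
      + c * srwSqMom d n (fun k => w' k * Dsin d k) x
      + ∑ r, a r * srwTwist d n (fun k => w' k * Dsin d k) x (b r) := by
  have hd1 : 1 ≤ d := by omega
  have hDs1 : ∀ k : Fin d → ℝ, Dsin d k ≤ 1 := fun k =>
    (Dsin_le_inv hd1 k).trans (by
      rw [one_div]; exact inv_le_one_of_one_le₀ (by exact_mod_cast hd1))
  have hw0' : ∀ k, 0 ≤ w' k := fun k => (pow_nonneg (abs_nonneg _) l).trans (hle k)
  have e : srwU d n l x =
      (∫ k, ((|Dhat d k| ^ l * Dsin d k) * |DhatSym d x k|) * Chat d 1 k ^ n ∂P d) / (2 * π) ^ d := by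
    rw [srwU]
    congr 1
    refine integral_congr_ae (ae_of_all _ fun k => ?_)
    show (|Dhat d k| ^ l * |DhatSym d x k| * Dsin d k) * Chat d 1 k ^ n =
      ((|Dhat d k| ^ l * Dsin d k) * |DhatSym d x k|) * Chat d 1 k ^ n
    ring
  rw [e]
  exact integral_weight_abs_DhatSym_le_of_trigMajorant_of_le hd
    (fun k => mul_nonneg (pow_nonneg (abs_nonneg _) l) (Dsin_nonneg k))
    (fun k => mul_le_mul_of_nonneg_right (hle k) (Dsin_nonneg k))
    (hw'.mul (continuous_Dsin d).measurable)
    (fun k => (mul_le_of_le_one_right (hw0' k) (hDs1 k)).trans (hw1 k)) x B c a b hmaj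

/-- **`KM₂_{n,l}(x)` under a dominating weight**: if `|D̂|^l ≤ w' ≤ W` (`w'` measurable, `d ≥ 2n+1`),
then `KM₂_{n,l}(x) ≤ B·Tw^{w' M̂²}_n(x;0) + c·Sq^{w' M̂²}_n(x) + Σ_r a_r·Tw^{w' M̂²}_n(x;b_r)`
(`0 ≤ M̂² ≤ 25`). [cite: FitznerVanDerHofstad2016NoBLE, (3.36)–(3.37) p. 1071; (5.9), (5.14) p. 1092] -/
theorem srwKM2_le_of_trigMajorant_of_le {n : ℕ} (hd : 2 * n + 1 ≤ d) (l : ℕ) (x : Fin d → ℤ)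
    {w' : (Fin d → ℝ) → ℝ} (hle : ∀ k, |Dhat d k| ^ l ≤ w' k) (hw' : Measurable w') {W : ℝ}
    (hw1 : ∀ k, w' k ≤ W) {R : ℕ} (B c : ℝ) (a b : Fin R → ℝ)
    (hmaj : ∀ t ∈ Set.Icc (-1 : ℝ) 1, |t| ≤ B + c * t ^ 2 + ∑ r, a r * Real.cos (b r * t)) :
    srwKM2 d n l x ≤ B * srwTwist d n (fun k => w' k * Mhat d k ^ 2) x 0
      + c * srwSqMom d n (fun k => w' k * Mhat d k ^ 2) x
      + ∑ r, a r * srwTwist d n (fun k => w' k * Mhat d k ^ 2) x (b r) := by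
  have hd1 : 1 ≤ d := by omega
  have hw0' : ∀ k, 0 ≤ w' k := fun k => (pow_nonneg (abs_nonneg _) l).trans (hle k)
  have hM : ∀ k : Fin d → ℝ, Mhat d k ^ 2 ≤ 25 := fun k => by
    have h := abs_Dhat_pow_mul_Mhat_sq_le hd1 0 k
    rwa [pow_zero, one_mul] at h
  have e : srwKM2 d n l x =
      (∫ k, ((|Dhat d k| ^ l * Mhat d k ^ 2) * |DhatSym d x k|) * Chat d 1 k ^ n ∂P d) / (2 * π) ^ d := by
    rw [srwKM2]
    congr 1
    refine integral_congr_ae (ae_of_all _ fun k => ?_)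
    show (|Dhat d k| ^ l * |DhatSym d x k| * Mhat d k ^ 2) * Chat d 1 k ^ n =
      ((|Dhat d k| ^ l * Mhat d k ^ 2) * |DhatSym d x k|) * Chat d 1 k ^ n
    ring
  rw [e]
  exact integral_weight_abs_DhatSym_le_of_trigMajorant_of_le hd
    (fun k => mul_nonneg (pow_nonneg (abs_nonneg _) l) (sq_nonneg _))
    (fun k => mul_le_mul_of_nonneg_right (hle k) (sq_nonneg _))
    (hw'.mul ((measurable_Mhat d).pow_const 2))
    (fun k => mul_le_mul (hw1 k) (hM k) (sq_nonneg _) ((hw0' k).trans (hw1 k))) x B c a b hmaj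

/-- **`KM₂_{n,l}(x; d)` by the global separable majorant `gset`** (`d ≥ 2n+1`, any `l`, any `x`): the
bound of `srwKM2_le_of_trigMajorant` with the literal coefficients of `gset` and the weight `|D̂|^l M̂²`
(completing `srwK_le_gset` / `srwU_le_gset`).
[cite: FitznerVanDerHofstad2016NoBLE, (3.36)–(3.37) p. 1071; (5.9), (5.14) p. 1092; §5.1.2 (5.11)–(5.16) pp. 1091–1092] -/
theorem srwKM2_le_gset {n : ℕ} (hd : 2 * n + 1 ≤ d) (l : ℕ) (x : Fin d → ℤ) :
    srwKM2 d n l x ≤ (MajCert.gset.B : ℝ) * srwTwist d n (fun k => |Dhat d k| ^ l * Mhat d k ^ 2) x 0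
      + (MajCert.gset.c : ℝ) * srwSqMom d n (fun k => |Dhat d k| ^ l * Mhat d k ^ 2) x
      + ∑ r, gsetA r * srwTwist d n (fun k => |Dhat d k| ^ l * Mhat d k ^ 2) x (gsetB r) :=
  srwKM2_le_of_trigMajorant hd l x _ _ gsetA gsetB abs_le_trigMaj_gset

/-! ### Even `l`: the weight is already a polynomial -/

/-- For even `l`, `|D̂|^l g = D̂^l g` as weights of the twisted moment.
[cite: FitznerVanDerHofstad2016NoBLE, (3.36) p. 1071] -/
theorem srwTwist_abs_Dhat_pow_mul_eq_of_even {l : ℕ} (hl : Even l) (n : ℕ) (g : (Fin d → ℝ) → ℝ)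
    (x : Fin d → ℤ) (β : ℝ) :
    srwTwist d n (fun k => |Dhat d k| ^ l * g k) x β = srwTwist d n (fun k => Dhat d k ^ l * g k) x β := by
  simp only [hl.pow_abs]

/-- For even `l`, `|D̂|^l = D̂^l` as a weight of the twisted moment.
[cite: FitznerVanDerHofstad2016NoBLE, (3.36) p. 1071] -/
theorem srwTwist_abs_Dhat_pow_eq_of_even {l : ℕ} (hl : Even l) (n : ℕ) (x : Fin d → ℤ) (β : ℝ) :
    srwTwist d n (fun k => |Dhat d k| ^ l) x β = srwTwist d n (fun k => Dhat d k ^ l) x β := by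
  simp only [hl.pow_abs]

/-- For even `l`, `|D̂|^l g = D̂^l g` as weights of the second moment `Sq^w_n(x)`.
[cite: FitznerVanDerHofstad2016NoBLE, (3.36) p. 1071; (5.9) p. 1092] -/
theorem srwSqMom_abs_Dhat_pow_mul_eq_of_even {l : ℕ} (hl : Even l) (n : ℕ) (g : (Fin d → ℝ) → ℝ)
    (x : Fin d → ℤ) :
    srwSqMom d n (fun k => |Dhat d k| ^ l * g k) x = srwSqMom d n (fun k => Dhat d k ^ l * g k) x := by
  simp only [hl.pow_abs]

/-- For even `l`, `|D̂|^l = D̂^l` as a weight of the second moment `Sq^w_n(x)`.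
[cite: FitznerVanDerHofstad2016NoBLE, (3.36) p. 1071; (5.9) p. 1092] -/
theorem srwSqMom_abs_Dhat_pow_eq_of_even {l : ℕ} (hl : Even l) (n : ℕ) (x : Fin d → ℤ) :
    srwSqMom d n (fun k => |Dhat d k| ^ l) x = srwSqMom d n (fun k => Dhat d k ^ l) x := by
  simp only [hl.pow_abs]

/-! ### Odd `l`: the arithmetic–geometric polynomial majorant -/

/-- `|t|^{2j+1} ≤ (t^{2j} + t^{2j+2})/2` for every real `t` (`2|t| ≤ 1 + t²`). [folklore] -/
private theorem abs_pow_two_mul_add_one_le (j : ℕ) (t : ℝ) :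
    |t| ^ (2 * j + 1) ≤ (t ^ (2 * j) + t ^ (2 * j + 2)) / 2 := by
  have h2j : |t| ^ (2 * j) = t ^ (2 * j) := (even_two_mul j).pow_abs t
  have h0 : 0 ≤ t ^ (2 * j) := by rw [← h2j]; exact pow_nonneg (abs_nonneg t) _
  have hag : |t| ≤ (1 + t ^ 2) / 2 := by nlinarith [sq_nonneg (1 - |t|), sq_abs t]
  calc |t| ^ (2 * j + 1) = t ^ (2 * j) * |t| := by rw [pow_succ, h2j]
    _ ≤ t ^ (2 * j) * ((1 + t ^ 2) / 2) := mul_le_mul_of_nonneg_left hag h0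
    _ = (t ^ (2 * j) + t ^ (2 * j + 2)) / 2 := by ring

/-- **The polynomial dominating weight for odd `l`**: `|D̂(k)|^{2j+1} ≤ (D̂(k)^{2j} + D̂(k)^{2j+2})/2`.
[cite: FitznerVanDerHofstad2016NoBLE, (3.36) p. 1071] -/
theorem abs_Dhat_pow_odd_le_polyWeight (j : ℕ) (k : Fin d → ℝ) :
    |Dhat d k| ^ (2 * j + 1) ≤ (Dhat d k ^ (2 * j) + Dhat d k ^ (2 * j + 2)) / 2 :=
  abs_pow_two_mul_add_one_le j (Dhat d k)

/-- The polynomial weight `(D̂^{2j} + D̂^{2j+2})/2` is measurable.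
[cite: FitznerVanDerHofstad2016NoBLE, (3.36) p. 1071] -/
theorem measurable_polyWeight (j : ℕ) :
    Measurable fun k : Fin d → ℝ => (Dhat d k ^ (2 * j) + Dhat d k ^ (2 * j + 2)) / 2 :=
  ((((continuous_Dhat d).pow _).add ((continuous_Dhat d).pow _)).div_const 2).measurable

/-- The polynomial weight is at most `1` (`|D̂| ≤ 1`). [cite: FitznerVanDerHofstad2016NoBLE, (3.36) p. 1071] -/
theorem polyWeight_le_one (j : ℕ) (k : Fin d → ℝ) :
    (Dhat d k ^ (2 * j) + Dhat d k ^ (2 * j + 2)) / 2 ≤ 1 := by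
  have h1 : Dhat d k ^ (2 * j) ≤ 1 := by
    rw [← (even_two_mul j).pow_abs]; exact abs_Dhat_pow_le_one _ k
  have h2 : Dhat d k ^ (2 * j + 2) ≤ 1 := by
    rw [show 2 * j + 2 = 2 * (j + 1) by ring, ← (even_two_mul (j + 1)).pow_abs]
    exact abs_Dhat_pow_le_one _ k
  linarith

/-- **`K_{n,2j+1}(x; d)` by `gset` with a POLYNOMIAL weight** (`d ≥ 2n+1`, any `x`):
`K_{n,2j+1}(x) ≤ B·Tw^{w'}_n(x;0) + c·Sq^{w'}_n(x) + Σ_r a_r·Tw^{w'}_n(x;b_r)`, `w' = (D̂^{2j} + D̂^{2j+2})/2`,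
with the literal coefficients of `gset`.
[cite: FitznerVanDerHofstad2016NoBLE, (3.36) p. 1071; (5.9) p. 1092; §5.1.2 (5.11)–(5.16) pp. 1091–1092] -/
theorem srwK_le_gset_odd {n : ℕ} (hd : 2 * n + 1 ≤ d) (j : ℕ) (x : Fin d → ℤ) :
    srwK d n (2 * j + 1) x
      ≤ (MajCert.gset.B : ℝ) * srwTwist d n (fun k => (Dhat d k ^ (2 * j) + Dhat d k ^ (2 * j + 2)) / 2) x 0
      + (MajCert.gset.c : ℝ) * srwSqMom d n (fun k => (Dhat d k ^ (2 * j) + Dhat d k ^ (2 * j + 2)) / 2) x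
      + ∑ r, gsetA r
          * srwTwist d n (fun k => (Dhat d k ^ (2 * j) + Dhat d k ^ (2 * j + 2)) / 2) x (gsetB r) :=
  srwK_le_of_trigMajorant_of_le hd (2 * j + 1) x (abs_Dhat_pow_odd_le_polyWeight j)
    (measurable_polyWeight j) (polyWeight_le_one j) _ _ gsetA gsetB abs_le_trigMaj_gset

/-- **`U_{n,2j+1}(x; d)` by `gset` with a POLYNOMIAL weight** (`d ≥ 2n+1`, any `x`): the same bound with
the weight `w' D̂^{sin}`, `w' = (D̂^{2j} + D̂^{2j+2})/2`.
[cite: FitznerVanDerHofstad2016NoBLE, (3.38) p. 1071; (5.9) p. 1092; §5.1.2 (5.11)–(5.16) pp. 1091–1092] -/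
theorem srwU_le_gset_odd {n : ℕ} (hd : 2 * n + 1 ≤ d) (j : ℕ) (x : Fin d → ℤ) :
    srwU d n (2 * j + 1) x
      ≤ (MajCert.gset.B : ℝ)
          * srwTwist d n (fun k => (Dhat d k ^ (2 * j) + Dhat d k ^ (2 * j + 2)) / 2 * Dsin d k) x 0
      + (MajCert.gset.c : ℝ)
          * srwSqMom d n (fun k => (Dhat d k ^ (2 * j) + Dhat d k ^ (2 * j + 2)) / 2 * Dsin d k) x
      + ∑ r, gsetA r
          * srwTwist d n (fun k => (Dhat d k ^ (2 * j) + Dhat d k ^ (2 * j + 2)) / 2 * Dsin d k) x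
              (gsetB r) :=
  srwU_le_of_trigMajorant_of_le hd (2 * j + 1) x (abs_Dhat_pow_odd_le_polyWeight j)
    (measurable_polyWeight j) (polyWeight_le_one j) _ _ gsetA gsetB abs_le_trigMaj_gset

/-- **`KM₂_{n,2j+1}(x; d)` by `gset` with a POLYNOMIAL weight** (`d ≥ 2n+1`, any `x`): the same bound with
the weight `w' M̂²`, `w' = (D̂^{2j} + D̂^{2j+2})/2`.
[cite: FitznerVanDerHofstad2016NoBLE, (3.36)–(3.37) p. 1071; (5.9), (5.14) p. 1092] -/
theorem srwKM2_le_gset_odd {n : ℕ} (hd : 2 * n + 1 ≤ d) (j : ℕ) (x : Fin d → ℤ) :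
    srwKM2 d n (2 * j + 1) x
      ≤ (MajCert.gset.B : ℝ)
          * srwTwist d n (fun k => (Dhat d k ^ (2 * j) + Dhat d k ^ (2 * j + 2)) / 2 * Mhat d k ^ 2) x 0
      + (MajCert.gset.c : ℝ)
          * srwSqMom d n (fun k => (Dhat d k ^ (2 * j) + Dhat d k ^ (2 * j + 2)) / 2 * Mhat d k ^ 2) x
      + ∑ r, gsetA r
          * srwTwist d n (fun k => (Dhat d k ^ (2 * j) + Dhat d k ^ (2 * j + 2)) / 2 * Mhat d k ^ 2) x
              (gsetB r) :=
  srwKM2_le_of_trigMajorant_of_le hd (2 * j + 1) x (abs_Dhat_pow_odd_le_polyWeight j)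
    (measurable_polyWeight j) (polyWeight_le_one j) _ _ gsetA gsetB abs_le_trigMaj_gset

end Literature.Probability.FitznerVanDerHofstad2017

end
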